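import Summits.CriticalPhenomena.Ising3DConformalLimit.Theses.FKParityRobustness
import Summits.CriticalPhenomena.Ising3DConformalLimit.Theses.EnergyNotSigmaSquared
import Summits.CriticalPhenomena.Ising3DConformalLimit.Theorems.FKParityRobustnessIndependentStrandsJoinLimitDictionary
import Summits.CriticalPhenomena.Ising3DConformalLimit.Theorems.FKParityRobustnessFarMergingGivesU4
import Summits.CriticalPhenomena.Ising3DConformalLimit.Theorems.FKParityRobustnessJoinForcesU4
import HarnessLib

/-!
# The crux `IndependentStrandsJoin` reduced to EXISTING items plus ONE continuum statement
# (registered sub-goal `stub_continuumResidual`; line `pinch-to-tetra`, reshape r3)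

(crux item stmt-CriticalPhenomena-14625, route `FKParityRobustness`, sub-problem `Ising3DConformalLimit`; lead
`prover-line-stmt-CriticalPhenomena-14625-c2-0`, 2026-08-17; `--supports stmt-CriticalPhenomena-14625`.)

Pure glue over landed theorems; no new definition.  Write `y_A` for the regular tetrahedron `tetra` cast to `ℝ³`
(`yTetra`) and, for a family `S : CorrFamily 3`, `U₄(S) = limitConnectedFour S`.  The **tetrahedral non-vanishing**
statement (spelled out inline below, never abbreviated) is

  `TNV`  : for every non-degenerate pointwise scaling limit `(ρ, S)` of `criticalCorr 3`:
           `HasNontrivialU4 S → U₄(S)(y_A) < 0`;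
  `TNVᴹ` : the same restricted to MÖBIUS-COVARIANT limits `(ρ, Δ, S)` (weaker).

Results (axioms `propext`, `Classical.choice`, `Quot.sound`):
* `independentStrandsJoin_of_limit_farMerging_tnv` — `LimitExists →` (far merging i.o. at SOME injective lattice
  shape, the antecedent of the landed `FarMergingGivesU4`) `→ TNV → IndependentStrandsJoin`;
* `independentStrandsJoin_of_limit_gap_gffm_tnv` — `LimitExists → EnergyGapPowerLaw → GapForcesFarMerging → TNV →
  IndependentStrandsJoin`: the crux from the existence of the limit (⊂ item stmt-CriticalPhenomena-1344, implied by
  stmt-CriticalPhenomena-1981), the two cruxes of route `EnergyNotSigmaSquared` VERBATIM (items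
  stmt-CriticalPhenomena-4469, stmt-CriticalPhenomena-4468 — whatever line proves them) and `TNV`;
* `independentStrandsJoin_of_moebius_gap_gffm_tnvM` = registered sub-goal `Theorems.stub_continuumResidual` —
  `MoebiusLimit → EnergyGapPowerLaw → GapForcesFarMerging → TNVᴹ → IndependentStrandsJoin`, with `MoebiusLimit` the
  route's OWN rank-crux item stmt-CriticalPhenomena-1344 verbatim (already a binder of the route's deciding theorem,
  so it costs the route nothing) and the residual in its weakest form;
* `independentStrandsJoin_of_limit_gap_pt_tnv` — the line `pinch-to-tetra` with the continuum transfer `TNV` in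
  place of the lattice `OctaveTransfer` (`LimitExists → EnergyGapPowerLaw → PinchedTransparency → TNV → crux`);
* calibration (the residual does not overshoot): `tnv_of_independentStrandsJoin`, `tnvM_of_independentStrandsJoin` —
  the crux implies `TNV` and `TNVᴹ` outright (landed `limitU4_tetra_le_of_independentStrandsJoin`), so modulo the
  existing items the crux IS `TNVᴹ`: "the continuum Ursell function of the (Möbius-covariant) critical Ising
  limit, if not identically zero, is non-zero at the regular tetrahedron (cross-ratios `u = v = 1`, the
  `S₃`-fixed point `z = e^{iπ/3}`)";
* `ising3DConformalLimit_of_moebius_gap_gffm_tnvM` — consequently the SUB-PROBLEM follows from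
  `MoebiusLimit ∧ EnergyGapPowerLaw ∧ GapForcesFarMerging ∧ TNVᴹ` (route deciding theorem `closes` with the proved
  bridge `joinForcesU4_proof`).
References: M. Aizenman, Comm. Math. Phys. 86 (1982) [AizenmanCMP1982]; S. Rychkov, D. Simmons-Duffin, B. Zan,
JHEP 2017, arXiv:1612.02436 [RychkovSimmonsDuffinZan2017] (the tetrahedral point is `Q_min`).
-/

noncomputable section

open Filter Topology Finset
open Literature.Probability.LatticeModels
open Summit.CriticalPhenomena.Ising3DConformalLimit.Theses.FKParityRobustness
open Summit.CriticalPhenomena.Ising3DConformalLimit.Theses.EnergyNotSigmaSquared (EnergyGapPowerLaw GapForcesFarMerging)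
open Summit.CriticalPhenomena.Ising3DConformalLimit.Theorems.GapForcesFarMerging.Negative
  (cc2 PinchedTransparencyShape)
open Summit.CriticalPhenomena.Ising3DConformalLimit.FKParityRobustnessFarMergingGivesU4 (farMergingGivesU4_proof)
open Summit.CriticalPhenomena.Ising3DConformalLimit.FKParityRobustnessJoinForcesU4 (joinForcesU4_proof)
open Summit.CriticalPhenomena.Ising3DConformalLimit.Cruxes.ParityRobustMerging.PlaquetteXorSurgery (tetra tetra_inj)

namespace Summit.CriticalPhenomena.Ising3DConformalLimit.Cruxes.IndependentStrandsJoin.PinchToTetra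

/-! ## The reductions -/

/-- **Limit + far merging somewhere + `TNV` ⟹ crux.**  Far merging along infinitely many dilations of SOME injective
lattice shape gives `U₄(S) ≢ 0` for the posited limit (landed `farMergingGivesU4_proof`, item stmt-CriticalPhenomena-4471);
`TNV` localises it at the regular tetrahedron; the landed dictionary (`independentStrandsJoin_iff_limitU4_tetra_neg`, ←)
returns to the lattice crux. [folklore] -/
theorem independentStrandsJoin_of_limit_farMerging_tnv (hL : LimitExists)
    (hfm : ∃ c : ℝ, 0 < c ∧ ∃ x : Fin 4 → Site 3, Function.Injective x ∧ ∀ L₀ : ℕ, ∃ L : ℕ, L₀ ≤ L ∧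
      criticalCorr 3 4 (fun i => (L : ℤ) • x i) -
          (criticalCorr 3 2 ![(L : ℤ) • x 0, (L : ℤ) • x 1] * criticalCorr 3 2 ![(L : ℤ) • x 2, (L : ℤ) • x 3] +
            criticalCorr 3 2 ![(L : ℤ) • x 0, (L : ℤ) • x 2] * criticalCorr 3 2 ![(L : ℤ) • x 1, (L : ℤ) • x 3] +
            criticalCorr 3 2 ![(L : ℤ) • x 0, (L : ℤ) • x 3] * criticalCorr 3 2 ![(L : ℤ) • x 1, (L : ℤ) • x 2]) ≤
        -(c * (criticalCorr 3 2 ![(L : ℤ) • x 0, (L : ℤ) • x 1] * criticalCorr 3 2 ![(L : ℤ) • x 2, (L : ℤ) • x 3])))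
    (htnv : ∀ (ρ : ℝ → ℝ) (S : CorrFamily 3), (∀ δ ∈ Set.Ioc (0:ℝ) 1, 0 < ρ δ) →
      HasPointwiseScalingLimit (criticalCorr 3) ρ S → IsNondegenerateTwoPoint S → HasNontrivialU4 S →
      limitConnectedFour S yTetra < 0) :
    IndependentStrandsJoin := by
  obtain ⟨ρ, S, hρ, hlim, hnd⟩ := hL
  have hU4 : HasNontrivialU4 S := farMergingGivesU4_proof hfm ρ S hρ hlim hnd
  exact (independentStrandsJoin_iff_limitU4_tetra_neg hρ hlim hnd).2 (htnv ρ S hρ hlim hnd hU4)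

/-- **Limit + the two `EnergyNotSigmaSquared` cruxes VERBATIM + `TNV` ⟹ crux.**  (`GapForcesFarMerging` is
`EnergyGapPowerLaw →` far merging i.o. at some injective lattice shape; items stmt-CriticalPhenomena-4469 / 4468.)
[folklore] -/
theorem independentStrandsJoin_of_limit_gap_gffm_tnv (hL : LimitExists) (hgap : EnergyGapPowerLaw)
    (hgffm : GapForcesFarMerging)
    (htnv : ∀ (ρ : ℝ → ℝ) (S : CorrFamily 3), (∀ δ ∈ Set.Ioc (0:ℝ) 1, 0 < ρ δ) →
      HasPointwiseScalingLimit (criticalCorr 3) ρ S → IsNondegenerateTwoPoint S → HasNontrivialU4 S →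
      limitConnectedFour S yTetra < 0) :
    IndependentStrandsJoin :=
  independentStrandsJoin_of_limit_farMerging_tnv hL (hgffm hgap) htnv

/-- **The route-level form: `MoebiusLimit` (item stmt-CriticalPhenomena-1344 verbatim) + the two `EnergyNotSigmaSquared`
cruxes + `TNVᴹ` (tetrahedral non-vanishing for MÖBIUS-COVARIANT limits only) ⟹ crux.** [folklore] -/
theorem independentStrandsJoin_of_moebius_gap_gffm_tnvM (hM : MoebiusLimit) (hgap : EnergyGapPowerLaw)
    (hgffm : GapForcesFarMerging)
    (htnvM : ∀ (ρ : ℝ → ℝ) (Δ : ℝ) (S : CorrFamily 3), (∀ δ ∈ Set.Ioc (0:ℝ) 1, 0 < ρ δ) →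
      HasPointwiseScalingLimit (criticalCorr 3) ρ S → IsNondegenerateTwoPoint S → IsMoebiusCovariant Δ S →
      HasNontrivialU4 S → limitConnectedFour S yTetra < 0) :
    IndependentStrandsJoin := by
  obtain ⟨ρ, Δ, S, hρ, -, hlim, hnd, hmob⟩ := hM
  have hU4 : HasNontrivialU4 S := farMergingGivesU4_proof (hgffm hgap) ρ S hρ hlim hnd
  exact (independentStrandsJoin_iff_limitU4_tetra_neg hρ hlim hnd).2 (htnvM ρ Δ S hρ hlim hnd hmob hU4)

/-- **The line `pinch-to-tetra` with the continuum transfer**: `LimitExists → EnergyGapPowerLaw →` pinched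
transparency `→ TNV → crux` (thin merging i.o. at the named injective shape `Th(2^ℓ)` gives `U₄(S) ≢ 0`, landed
`hasNontrivialU4_of_gap_pt`). [folklore] -/
theorem independentStrandsJoin_of_limit_gap_pt_tnv (hL : LimitExists) (hgap : EnergyGapPowerLaw)
    (hpt : PinchedTransparencyShape cc2 (criticalCorr 3 4))
    (htnv : ∀ (ρ : ℝ → ℝ) (S : CorrFamily 3), (∀ δ ∈ Set.Ioc (0:ℝ) 1, 0 < ρ δ) →
      HasPointwiseScalingLimit (criticalCorr 3) ρ S → IsNondegenerateTwoPoint S → HasNontrivialU4 S →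
      limitConnectedFour S yTetra < 0) :
    IndependentStrandsJoin := by
  obtain ⟨ρ, S, hρ, hlim, hnd⟩ := hL
  exact (independentStrandsJoin_iff_limitU4_tetra_neg hρ hlim hnd).2
    (htnv ρ S hρ hlim hnd (hasNontrivialU4_of_gap_pt hgap hpt ρ S hρ hlim hnd))

/-! ## Calibration: the residual is implied by the crux (it does not overshoot) -/

/-- **Crux ⟹ `TNV`** (indeed the conclusion `U₄(S)(y_A) < 0` for EVERY non-degenerate limit, with no use of
`HasNontrivialU4`): landed `limitU4_tetra_le_of_independentStrandsJoin` and positivity of `S₂`. [folklore] -/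
theorem tnv_of_independentStrandsJoin (h : IndependentStrandsJoin) :
    ∀ (ρ : ℝ → ℝ) (S : CorrFamily 3), (∀ δ ∈ Set.Ioc (0:ℝ) 1, 0 < ρ δ) →
      HasPointwiseScalingLimit (criticalCorr 3) ρ S → IsNondegenerateTwoPoint S → HasNontrivialU4 S →
      limitConnectedFour S yTetra < 0 :=
  fun _ _ hρ hlim hnd _ => (independentStrandsJoin_iff_limitU4_tetra_neg hρ hlim hnd).1 h

/-- **Crux ⟹ `TNVᴹ`** (a fortiori). [folklore] -/
theorem tnvM_of_independentStrandsJoin (h : IndependentStrandsJoin) :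
    ∀ (ρ : ℝ → ℝ) (Δ : ℝ) (S : CorrFamily 3), (∀ δ ∈ Set.Ioc (0:ℝ) 1, 0 < ρ δ) →
      HasPointwiseScalingLimit (criticalCorr 3) ρ S → IsNondegenerateTwoPoint S → IsMoebiusCovariant Δ S →
      HasNontrivialU4 S → limitConnectedFour S yTetra < 0 :=
  fun _ _ _ hρ hlim hnd _ _ => (independentStrandsJoin_iff_limitU4_tetra_neg hρ hlim hnd).1 h

/-- **Modulo the existing items the crux IS the continuum residual**: under `MoebiusLimit`, `EnergyGapPowerLaw` and
`GapForcesFarMerging`, `IndependentStrandsJoin ↔ TNVᴹ`. [folklore] -/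
theorem independentStrandsJoin_iff_tnvM (hM : MoebiusLimit) (hgap : EnergyGapPowerLaw) (hgffm : GapForcesFarMerging) :
    IndependentStrandsJoin ↔
      ∀ (ρ : ℝ → ℝ) (Δ : ℝ) (S : CorrFamily 3), (∀ δ ∈ Set.Ioc (0:ℝ) 1, 0 < ρ δ) →
        HasPointwiseScalingLimit (criticalCorr 3) ρ S → IsNondegenerateTwoPoint S → IsMoebiusCovariant Δ S →
        HasNontrivialU4 S → limitConnectedFour S yTetra < 0 :=
  ⟨tnvM_of_independentStrandsJoin, independentStrandsJoin_of_moebius_gap_gffm_tnvM hM hgap hgffm⟩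

/-! ## Consequence for the sub-problem -/

/-- **`MoebiusLimit ∧ EnergyGapPowerLaw ∧ GapForcesFarMerging ∧ TNVᴹ ⟹ Ising3DConformalLimit`**: the route's
deciding theorem `closes : IndependentStrandsJoin → JoinForcesU4 → MoebiusLimit → Ising3DConformalLimit` fed with the
reduction above and the PROVED bridge `joinForcesU4_proof` (item stmt-CriticalPhenomena-14627). [folklore] -/
theorem ising3DConformalLimit_of_moebius_gap_gffm_tnvM (hM : MoebiusLimit) (hgap : EnergyGapPowerLaw)
    (hgffm : GapForcesFarMerging)
    (htnvM : ∀ (ρ : ℝ → ℝ) (Δ : ℝ) (S : CorrFamily 3), (∀ δ ∈ Set.Ioc (0:ℝ) 1, 0 < ρ δ) →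
      HasPointwiseScalingLimit (criticalCorr 3) ρ S → IsNondegenerateTwoPoint S → IsMoebiusCovariant Δ S →
      HasNontrivialU4 S → limitConnectedFour S yTetra < 0) :
    _root_.Ising3DConformalLimit :=
  closes (independentStrandsJoin_of_moebius_gap_gffm_tnvM hM hgap hgffm htnvM) joinForcesU4_proof hM

end Summit.CriticalPhenomena.Ising3DConformalLimit.Cruxes.IndependentStrandsJoin.PinchToTetra

/-! ## The registered sub-goal `stub_continuumResidual` -/

namespace Summit.CriticalPhenomena.Ising3DConformalLimit.Theorems

open Summit.CriticalPhenomena.Ising3DConformalLimit.Cruxes.IndependentStrandsJoin.PinchToTetra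
open Summit.CriticalPhenomena.Ising3DConformalLimit.Cruxes.ParityRobustMerging.PlaquetteXorSurgery (tetra)

/-- **Registered sub-goal `stub_continuumResidual` of the crux `IndependentStrandsJoin`** (stmt-CriticalPhenomena-14625):
the crux follows from the route's own item `MoebiusLimit` (stmt-CriticalPhenomena-1344), the two cruxes of route
`EnergyNotSigmaSquared` (stmt-CriticalPhenomena-4469, stmt-CriticalPhenomena-4468) verbatim, and tetrahedral
non-vanishing of the continuum Ursell function for Möbius-covariant limits. -/
theorem stub_continuumResidual :
    MoebiusLimit → Summit.CriticalPhenomena.Ising3DConformalLimit.Theses.EnergyNotSigmaSquared.EnergyGapPowerLaw →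
      Summit.CriticalPhenomena.Ising3DConformalLimit.Theses.EnergyNotSigmaSquared.GapForcesFarMerging →
      (∀ (ρ : ℝ → ℝ) (Δ : ℝ) (S : CorrFamily 3), (∀ δ ∈ Set.Ioc (0:ℝ) 1, 0 < ρ δ) →
        HasPointwiseScalingLimit (criticalCorr 3) ρ S → IsNondegenerateTwoPoint S → IsMoebiusCovariant Δ S →
        HasNontrivialU4 S → limitConnectedFour S (fun i => WithLp.toLp 2 fun k => ((tetra i k : ℤ) : ℝ)) < 0) →
      IndependentStrandsJoin :=
  fun hM hgap hgffm htnvM => independentStrandsJoin_of_moebius_gap_gffm_tnvM hM hgap hgffm htnvM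

end Summit.CriticalPhenomena.Ising3DConformalLimit.Theorems

end
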